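import Mathlib
import HarnessLib
import Summits.NavierStokesRegularity.NavierStokesRegularity.Theorems.PoloidalWindowDoorLrcModEntireRidgeSecondOrder

/-!
# Item `LrcModEntire` (stmt-NavierStokesRegularity-20428), registry twist_split v8 — THE FLAT LEVER, rung (F-ii): the leading coefficient of ANY order of a quasiconvex family is quasiconvex
LEAD of item 20428 ns-poloidal-K2-p3 g15 (`--supports stmt-NavierStokesRegularity-20428 --as helper`).  Memo `Cruxes/LrcModEntire/T2B-g15.md` §17 (the flat sub-cell
`stub_T2bFlat` to fourth order): along an arc of a FLAT hot branch the cross-section maximum at height `z` expands as `R(s; z) = N − z⁴·m(s) + O(z⁵)` (quartic normal form,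
§17b–c), and Peakless makes `s ↦ R(s; z)` quasiconvex (`…RidgeQuasiconvex.crossSectionMax_quasiconvexOn_of_peakless`).  The second-order coefficient lemma
`…RidgeSecondOrder.quasiconvexOn_coeff_of_expansion` (κ > 0 lever, expansion in `z²`) is here extended to an arbitrary power:
* `quasiconvexOn_coeff_of_expansion_pow` — if `|R(s,z) − N − m(s)·zᵏ| ≤ C′ zᵏ⁺¹` for `s ∈ S` and `0 < z ≤ δ′` (one side suffices), and each `s ↦ R(s,z)` is quasiconvex on the
  convex set `S`, then `m` is quasiconvex on `S` (normalise by `z⁻ᵏ > 0`, pass to the limit `z → 0⁺` with `quasiconvexOn_of_tendsto_eventually`);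
* `abs_sSup_sub_le_of_quarticRidgeExpansion` (rung F-i) — the QUARTIC TUBE: if `|g(n,z) − (N − Q(n,z))| ≤ C(|n|+|z|)⁵` with `Q` a positive-definite binary quartic
  (`λ(n⁴+z⁴) ≤ Q`), `m = min_η Q(η,1)` attained at `|η₀| ≤ K`, `64Cr ≤ λ`, then `|max_{|n|≤r} g(·,z) − (N − m z⁴)| ≤ C″|z|⁵` (explicit `C″`; the maximiser sits at `|n*| ≤ B|z|`);
* `abs_sSup_sub_le_of_quarticRidgeExpansion'` — the same with `Q` any degree-4-homogeneous function (`Q(ηt,t) = t⁴Q(η,1)`), the form instantiated by `D⁴θ(y)[(nν+ze₂)⁴]`;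
* `quasiconcaveOn_coeff_of_expansion_pow` — the same with `R(s,z) = N − m(s)zᵏ + O(zᵏ⁺¹)`: then `m` is quasiCONCAVE (the flat lever's `m(s) = min_η Q_s(η,1) ≥ 0` has no strict
  interior local minimum).
WHAT THIS IS NOT: not a claim about Navier–Stokes regularity and not a proof of `stub_T2bFlat` — a class-free rung of the flat lever (bears_on LADDER-NS N0, item 20428 / crux 19708;
OPEN, ⟨27893⟩ OPEN).
-/

set_option linter.style.longLine false
-- the summit and its single sub-problem share the name (CONVENTIONS §1), as in every Theorems file
set_option linter.dupNamespace false

namespace Summit.NavierStokesRegularity.NavierStokesRegularity.Theorems.PoloidalWindowDoorLrcModEntireTwistingTHFlatLever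

open Set Filter Topology
open Summit.NavierStokesRegularity.NavierStokesRegularity.Theorems.PoloidalWindowDoorLrcModEntireRidgeSecondOrder

/-- **The `k`-th order coefficient of a one-sided expansion of a quasiconvex family is quasiconvex.**  If `|R(s,z) − N − m(s)zᵏ| ≤ C′zᵏ⁺¹` for `s ∈ S`, `0 < z ≤ δ′`,
and `s ↦ R(s,z)` is quasiconvex on the convex set `S` for every such `z`, then `m` is quasiconvex on `S`. -/
theorem quasiconvexOn_coeff_of_expansion_pow {S : Set ℝ} (hS : Convex ℝ S) {R : ℝ → ℝ → ℝ} {m : ℝ → ℝ} {N C' δ' : ℝ} (hδ' : 0 < δ') (k : ℕ)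
    (hexp : ∀ s ∈ S, ∀ z : ℝ, 0 < z → z ≤ δ' → |R s z - N - m s * z ^ k| ≤ C' * z ^ (k + 1))
    (hqc : ∀ z : ℝ, 0 < z → z ≤ δ' → QuasiconvexOn ℝ S fun s => R s z) :
    QuasiconvexOn ℝ S m := by
  -- the normalised family `F z s := z⁻ᵏ (R s z − N)`, quasiconvex for `0 < z ≤ δ'`, tends to `m s` as `z → 0⁺`
  set F : ℝ → ℝ → ℝ := fun z s => (z ^ k)⁻¹ * R s z + -((z ^ k)⁻¹ * N) with hFdef
  haveI : (𝓝[>] (0 : ℝ)).NeBot := nhdsGT_neBot 0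
  have hev : ∀ᶠ z in 𝓝[>] (0 : ℝ), 0 < z ∧ z ≤ δ' := by
    have h1 : ∀ᶠ z in 𝓝[>] (0 : ℝ), 0 < z := self_mem_nhdsWithin
    have h2 : ∀ᶠ z in 𝓝[>] (0 : ℝ), z ≤ δ' := by
      have : ∀ᶠ z in 𝓝 (0 : ℝ), z ≤ δ' := by
        filter_upwards [Metric.closedBall_mem_nhds (0 : ℝ) hδ'] with z hz
        rw [Metric.mem_closedBall, Real.dist_eq, sub_zero] at hz
        exact (le_abs_self z).trans hz
      exact nhdsWithin_le_nhds this
    filter_upwards [h1, h2] with z hz1 hz2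
    exact ⟨hz1, hz2⟩
  refine quasiconvexOn_of_tendsto_eventually (l := 𝓝[>] (0 : ℝ)) hS (F := F) ?_ ?_
  · filter_upwards [hev] with z hz
    exact quasiconvexOn_affine_pos (hqc z hz.1 hz.2) (by have := pow_pos hz.1 k; positivity) _
  · intro s hs
    have hC'0 : 0 ≤ C' := by
      have h := hexp s hs δ' hδ' le_rfl
      have := (abs_nonneg _).trans h
      have hδk : 0 < δ' ^ (k + 1) := by positivity
      nlinarith
    rw [Metric.tendsto_nhdsWithin_nhds]
    intro ε hε
    refine ⟨min δ' (ε / (C' + 1)), lt_min hδ' (by positivity), fun z hz0 hzd => ?_⟩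
    have hzpos : 0 < z := hz0
    rw [Real.dist_eq, sub_zero] at hzd
    have hzδ : z ≤ δ' := ((le_abs_self z).trans hzd.le).trans (min_le_left _ _)
    have hzε : z < ε / (C' + 1) := lt_of_le_of_lt (le_abs_self z) (lt_of_lt_of_le hzd (min_le_right _ _))
    have h := hexp s hs z hzpos hzδ
    have hzk : 0 < z ^ k := pow_pos hzpos k
    rw [Real.dist_eq]
    have e : F z s - m s = (z ^ k)⁻¹ * (R s z - N - m s * z ^ k) := by
      rw [hFdef]; field_simp; ring
    rw [e, abs_mul, abs_inv, abs_of_pos hzk]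
    have h3 : (z ^ k)⁻¹ * |R s z - N - m s * z ^ k| ≤ (z ^ k)⁻¹ * (C' * z ^ (k + 1)) :=
      mul_le_mul_of_nonneg_left h (by positivity)
    have h4 : (z ^ k)⁻¹ * (C' * z ^ (k + 1)) = C' * z := by
      rw [pow_succ]; field_simp
    have h5 : C' * z < ε := by
      have := (lt_div_iff₀ (by positivity : (0:ℝ) < C' + 1)).1 hzε
      nlinarith
    linarith [h3, h4]

/-- **Deficit form.**  If `|R(s,z) − N + m(s)zᵏ| ≤ C′zᵏ⁺¹` for `s ∈ S`, `0 < z ≤ δ′`, and each `s ↦ R(s,z)` is quasiconvex on the convex set `S`, then the deficit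
coefficient `m` is quasiconcave on `S` — in particular it has no strict local minimum in the interior of `S` (the form used by the flat lever, `R = N − z⁴m + O(z⁵)`, `m ≥ 0`). -/
theorem quasiconcaveOn_coeff_of_expansion_pow {S : Set ℝ} (hS : Convex ℝ S) {R : ℝ → ℝ → ℝ} {m : ℝ → ℝ} {N C' δ' : ℝ} (hδ' : 0 < δ') (k : ℕ)
    (hexp : ∀ s ∈ S, ∀ z : ℝ, 0 < z → z ≤ δ' → |R s z - N + m s * z ^ k| ≤ C' * z ^ (k + 1))
    (hqc : ∀ z : ℝ, 0 < z → z ≤ δ' → QuasiconvexOn ℝ S fun s => R s z) :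
    QuasiconcaveOn ℝ S m := by
  have h : QuasiconvexOn ℝ S fun s => -m s := by
    refine quasiconvexOn_coeff_of_expansion_pow (N := N) (C' := C') hS hδ' k (fun s hs z hz hzδ => ?_) hqc
    have e : R s z - N - -m s * z ^ k = R s z - N + m s * z ^ k := by ring
    rw [e]; exact hexp s hs z hz hzδ
  intro r
  have hc := h (-r)
  have e : {x | x ∈ S ∧ r ≤ m x} = {x | x ∈ S ∧ (fun s => -m s) x ≤ -r} := by
    ext x; simp only [mem_setOf_eq, neg_le_neg_iff]
  rw [e]; exact hc

/-! ### The quartic tube: the cross-section maximum over a fourth-order-flat ridge -/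

/-- `|x|⁵ = |x|·x⁴`. -/
theorem abs_pow_five (x : ℝ) : |x| ^ 5 = |x| * x ^ 4 := by
  have h : x ^ 4 = |x| ^ 4 := by rw [pow_abs, abs_of_nonneg (by positivity : (0:ℝ) ≤ x ^ 4)]
  rw [h]; ring

/-- `(a + b)⁵ ≤ 32(a⁵ + b⁵)` for `a, b ≥ 0` (crude: `a + b ≤ 2 max(a,b)`). -/
theorem add_pow_five_le {a b : ℝ} (ha : 0 ≤ a) (hb : 0 ≤ b) : (a + b) ^ 5 ≤ 32 * (a ^ 5 + b ^ 5) := by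
  have ha5 : 0 ≤ a ^ 5 := by positivity
  have hb5 : 0 ≤ b ^ 5 := by positivity
  rcases le_total a b with hab | hab
  · have h1 : a + b ≤ 2 * b := by linarith
    have h2 : (a + b) ^ 5 ≤ (2 * b) ^ 5 := pow_le_pow_left₀ (by positivity) h1 5
    have e : (2 * b) ^ 5 = 32 * b ^ 5 := by ring
    linarith
  · have h1 : a + b ≤ 2 * a := by linarith
    have h2 : (a + b) ^ 5 ≤ (2 * a) ^ 5 := pow_le_pow_left₀ (by positivity) h1 5
    have e : (2 * a) ^ 5 = 32 * a ^ 5 := by ring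
    linarith

/-- **THE QUARTIC-RIDGE MAXIMUM (flat lever, rung F-i).**  Let `g(n,z)` satisfy `|g(n,z) − (N − Q(n,z))| ≤ C(|n|+|z|)⁵` for `|n| ≤ r`, `|z| ≤ δ`, where
`Q(n,z) = q n⁴ + b zn³ + c₂ z²n² + c₃ z³n + c₄ z⁴` is a binary quartic with `λ(n⁴ + z⁴) ≤ Q(n,z)` (`λ > 0`), `m = min_η Q(η,1)` attained at `η₀` with `|η₀| ≤ K`,
`C ≥ 0`, `r > 0`, `64·C·r ≤ λ`, and `g(·,z)` continuous on `[−r,r]`.  Then for `|z| ≤ δ`, `|z| ≤ 1`, `K|z| ≤ r`: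
`|sSup (g(·,z) '' [−r,r]) − (N − m z⁴)| ≤ (C(K+1)⁵ + C(B+1)⁵)|z|⁵` with `B = max 1 (2(|m| + 32C + C(K+1)⁵)/λ)` — the cross-section maximum over a fourth-order-flat ridge is
`N − m z⁴ + O(z⁵)` (memo T2B-g15 §17b–c: `Q_s = q[(n²+c₀z²)² + 4c₀z²n²] + b·zn(n²+c₀z²)`, `m(s) = c₀²qM₀(b/(√c₀ q))`). -/
theorem abs_sSup_sub_le_of_quarticRidgeExpansion {g Q : ℝ → ℝ → ℝ} {N q b c₂ c₃ c₄ lam m η₀ K C r δ : ℝ}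
    (hQ : ∀ n z, Q n z = q * n ^ 4 + b * z * n ^ 3 + c₂ * z ^ 2 * n ^ 2 + c₃ * z ^ 3 * n + c₄ * z ^ 4)
    (hlam : 0 < lam) (hdef : ∀ n z, lam * (n ^ 4 + z ^ 4) ≤ Q n z)
    (hm : ∀ η, m ≤ Q η 1) (hη₀ : Q η₀ 1 = m) (hK : |η₀| ≤ K)
    (hC : 0 ≤ C) (hr : 0 < r) (hrC : 64 * C * r ≤ lam)
    (hH : ∀ n z : ℝ, |n| ≤ r → |z| ≤ δ → |g n z - (N - Q n z)| ≤ C * (|n| + |z|) ^ 5)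
    (hcont : ∀ z : ℝ, |z| ≤ δ → ContinuousOn (fun n => g n z) (Icc (-r) r))
    {z : ℝ} (hz : |z| ≤ δ) (hz1 : |z| ≤ 1) (hKz : K * |z| ≤ r) :
    |sSup ((fun n => g n z) '' Icc (-r) r) - (N - m * z ^ 4)| ≤
      (C * (K + 1) ^ 5 + C * (max 1 (2 * (|m| + 32 * C + C * (K + 1) ^ 5) / lam) + 1) ^ 5) * |z| ^ 5 := by
  -- the cross-section image is compact and non-empty: the `sSup` is attained and bounds every value
  have hIc : IsCompact ((fun n => g n z) '' Icc (-r) r) := isCompact_Icc.image_of_continuousOn (hcont z hz)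
  have hne : ((fun n => g n z) '' Icc (-r) r).Nonempty := ⟨g 0 z, 0, ⟨by linarith, hr.le⟩, rfl⟩
  obtain ⟨nstar, hnstar, hmax⟩ := hIc.sSup_mem hne
  have hle : ∀ n ∈ Icc (-r) r, g n z ≤ sSup ((fun n => g n z) '' Icc (-r) r) := fun n hn =>
    le_csSup hIc.bddAbove ⟨n, hn, rfl⟩
  set M := sSup ((fun n => g n z) '' Icc (-r) r) with hMdef
  have hK0 : 0 ≤ K := (abs_nonneg _).trans hK
  have hz0 : 0 ≤ |z| := abs_nonneg z
  set B : ℝ := max 1 (2 * (|m| + 32 * C + C * (K + 1) ^ 5) / lam) with hB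
  have hB1 : 1 ≤ B := le_max_left _ _
  have hB0 : 0 ≤ B := zero_le_one.trans hB1
  -- homogeneity of the quartic
  have hhom : ∀ η t : ℝ, Q (η * t) t = t ^ 4 * Q η 1 := fun η t => by rw [hQ, hQ]; ring
  -- ### lower bound at `n₁ = η₀ z`
  have hn₁r : |η₀ * z| ≤ r := by rw [abs_mul]; exact (mul_le_mul_of_nonneg_right hK hz0).trans hKz
  have hn₁mem : η₀ * z ∈ Icc (-r) r := ⟨(abs_le.1 hn₁r).1, (abs_le.1 hn₁r).2⟩
  have hlow : N - m * z ^ 4 - C * (K + 1) ^ 5 * |z| ^ 5 ≤ M := by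
    have h1 := (abs_le.1 (hH (η₀ * z) z hn₁r hz)).1
    have h2 := hle _ hn₁mem
    rw [hhom, hη₀] at h1
    have hrem : C * (|η₀ * z| + |z|) ^ 5 ≤ C * (K + 1) ^ 5 * |z| ^ 5 := by
      have e : |η₀ * z| + |z| = (|η₀| + 1) * |z| := by rw [abs_mul]; ring
      rw [e, mul_pow]
      have h3 : (|η₀| + 1) ^ 5 ≤ (K + 1) ^ 5 := pow_le_pow_left₀ (by positivity) (by linarith) 5
      have h4 : (|η₀| + 1) ^ 5 * |z| ^ 5 ≤ (K + 1) ^ 5 * |z| ^ 5 := mul_le_mul_of_nonneg_right h3 (by positivity)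
      have h5 := mul_le_mul_of_nonneg_left h4 hC
      have e2 : C * ((K + 1) ^ 5 * |z| ^ 5) = C * (K + 1) ^ 5 * |z| ^ 5 := by ring
      linarith [h5, e2]
    linarith [h1, h2, hrem]
  -- ### upper bound at the maximiser `n*`
  have hnr : |nstar| ≤ r := abs_le.2 ⟨hnstar.1, hnstar.2⟩
  have hM : M = g nstar z := hmax.symm
  have h1 := (abs_le.1 (hH nstar z hnr hz)).2
  -- `Q(n*, z) ≥ m z⁴`
  have hQm : m * z ^ 4 ≤ Q nstar z := by
    rcases eq_or_ne z 0 with hz' | hz'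
    · rw [hz']
      have h0 := hdef nstar 0
      have hn4 : 0 ≤ nstar ^ 4 := by positivity
      have e1 : m * (0:ℝ) ^ 4 = 0 := by ring
      have e2 : lam * (nstar ^ 4 + (0:ℝ) ^ 4) = lam * nstar ^ 4 := by ring
      rw [e1]; rw [e2] at h0
      exact (mul_nonneg hlam.le hn4).trans h0
    · have e : nstar = nstar / z * z := by field_simp
      rw [e, hhom, mul_comm]
      exact mul_le_mul_of_nonneg_left (hm _) (by positivity)
  -- the remainder at `n*` : `C(|n*|+|z|)⁵ ≤ 32C|n*|⁵ + 32C|z|⁵`, `32C|n*|⁵ ≤ (λ/2) n*⁴`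
  have hrem1 : C * (|nstar| + |z|) ^ 5 ≤ 32 * C * |nstar| ^ 5 + 32 * C * |z| ^ 5 := by
    have h := mul_le_mul_of_nonneg_left (add_pow_five_le (abs_nonneg nstar) hz0) hC
    linarith
  have hrem2 : 32 * C * |nstar| ^ 5 ≤ lam / 2 * nstar ^ 4 := by
    rw [abs_pow_five]
    have h32 : 32 * C * |nstar| ≤ lam / 2 := by
      have := mul_le_mul_of_nonneg_left hnr (by positivity : (0:ℝ) ≤ 32 * C)
      linarith
    calc 32 * C * (|nstar| * nstar ^ 4) = (32 * C * |nstar|) * nstar ^ 4 := by ring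
      _ ≤ lam / 2 * nstar ^ 4 := mul_le_mul_of_nonneg_right h32 (by positivity)
  -- smallness of the maximiser: `n*⁴ ≤ B z⁴`, hence `|n*| ≤ B|z|`
  have hz54 : |z| ^ 5 ≤ z ^ 4 := by
    rw [abs_pow_five]
    have h4 : 0 ≤ z ^ 4 := by positivity
    nlinarith
  have hsmall4 : nstar ^ 4 ≤ B * z ^ 4 := by
    have hd := hdef nstar z
    -- `λ(n*⁴ + z⁴) ≤ Q(n*,z) ≤ N − g(n*,z) + C(|n*|+|z|)⁵` and `g(n*,z) = M ≥ N − m z⁴ − C(K+1)⁵|z|⁵`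
    have hQup : Q nstar z ≤ m * z ^ 4 + C * (K + 1) ^ 5 * |z| ^ 5 + C * (|nstar| + |z|) ^ 5 := by
      have := hlow; rw [hM] at this; linarith
    have hmain : lam / 2 * nstar ^ 4 ≤ (|m| + 32 * C + C * (K + 1) ^ 5) * z ^ 4 := by
      have hmz : m * z ^ 4 ≤ |m| * z ^ 4 := mul_le_mul_of_nonneg_right (le_abs_self m) (by positivity)
      have hK5 : C * (K + 1) ^ 5 * |z| ^ 5 ≤ C * (K + 1) ^ 5 * z ^ 4 := mul_le_mul_of_nonneg_left hz54 (by positivity)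
      have h32 : 32 * C * |z| ^ 5 ≤ 32 * C * z ^ 4 := mul_le_mul_of_nonneg_left hz54 (by positivity)
      have hz4 : 0 ≤ lam * z ^ 4 := by positivity
      have e : (|m| + 32 * C + C * (K + 1) ^ 5) * z ^ 4 = |m| * z ^ 4 + 32 * C * z ^ 4 + C * (K + 1) ^ 5 * z ^ 4 := by ring
      rw [e]
      have hd' : lam * nstar ^ 4 + lam * z ^ 4 ≤ Q nstar z := by linarith [hd]
      linarith [hQup, hrem1, hrem2]
    have hB' : 2 * (|m| + 32 * C + C * (K + 1) ^ 5) / lam ≤ B := le_max_right _ _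
    have : nstar ^ 4 ≤ 2 * (|m| + 32 * C + C * (K + 1) ^ 5) / lam * z ^ 4 := by
      rw [div_mul_eq_mul_div, le_div_iff₀ hlam]; nlinarith
    exact this.trans (mul_le_mul_of_nonneg_right hB' (by positivity))
  have hsmall : |nstar| ≤ B * |z| := by
    have h4 : |nstar| ^ 4 ≤ (B * |z|) ^ 4 := by
      rw [pow_abs, mul_pow, pow_abs, abs_of_nonneg (by positivity : (0:ℝ) ≤ z ^ 4),
        abs_of_nonneg (by positivity : (0:ℝ) ≤ nstar ^ 4)]
      have hB3 : 1 ≤ B ^ 3 := one_le_pow₀ hB1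
      have hB4 : B ≤ B ^ 4 :=
        calc B = B * 1 := by ring
          _ ≤ B * B ^ 3 := mul_le_mul_of_nonneg_left hB3 hB0
          _ = B ^ 4 := by ring
      have hz4 : 0 ≤ z ^ 4 := by positivity
      exact hsmall4.trans (mul_le_mul_of_nonneg_right hB4 hz4)
    exact (pow_le_pow_iff_left₀ (abs_nonneg _) (by positivity) (by norm_num : (4:ℕ) ≠ 0)).1 h4
  have hup : M ≤ N - m * z ^ 4 + C * (B + 1) ^ 5 * |z| ^ 5 := by
    have hrem : C * (|nstar| + |z|) ^ 5 ≤ C * (B + 1) ^ 5 * |z| ^ 5 := by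
      have h3 : |nstar| + |z| ≤ (B + 1) * |z| := by
        have e : (B + 1) * |z| = B * |z| + |z| := by ring
        rw [e]; linarith
      have h4 : (|nstar| + |z|) ^ 5 ≤ ((B + 1) * |z|) ^ 5 := pow_le_pow_left₀ (by positivity) h3 5
      have h5 := mul_le_mul_of_nonneg_left h4 hC
      have e2 : C * ((B + 1) * |z|) ^ 5 = C * (B + 1) ^ 5 * |z| ^ 5 := by ring
      linarith [h5, e2]
    rw [hM]; linarith
  have hK5 : 0 ≤ C * (K + 1) ^ 5 * |z| ^ 5 := by positivity
  have hB5 : 0 ≤ C * (B + 1) ^ 5 * |z| ^ 5 := by positivity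
  have e : (C * (K + 1) ^ 5 + C * (B + 1) ^ 5) * |z| ^ 5 = C * (K + 1) ^ 5 * |z| ^ 5 + C * (B + 1) ^ 5 * |z| ^ 5 := by ring
  rw [e]
  exact abs_le.2 ⟨by linarith, by linarith⟩

/-- **THE QUARTIC-RIDGE MAXIMUM, homogeneous form** (the version the binder-level rung instantiates with `Q(n,z) = −D⁴(σv₂(−1,·))(γ s)[(nν+ze₂)⁴]/24`, homogeneous by
multilinearity — no symmetry of `D⁴` and no coefficient extraction needed): the same conclusion as `abs_sSup_sub_le_of_quarticRidgeExpansion` with the polynomial identity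
replaced by degree-4 homogeneity `Q(ηt, t) = t⁴Q(η,1)`. -/
theorem abs_sSup_sub_le_of_quarticRidgeExpansion' {g Q : ℝ → ℝ → ℝ} {N lam m η₀ K C r δ : ℝ}
    (hhom : ∀ η t : ℝ, Q (η * t) t = t ^ 4 * Q η 1)
    (hlam : 0 < lam) (hdef : ∀ n z, lam * (n ^ 4 + z ^ 4) ≤ Q n z)
    (hm : ∀ η, m ≤ Q η 1) (hη₀ : Q η₀ 1 = m) (hK : |η₀| ≤ K)
    (hC : 0 ≤ C) (hr : 0 < r) (hrC : 64 * C * r ≤ lam)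
    (hH : ∀ n z : ℝ, |n| ≤ r → |z| ≤ δ → |g n z - (N - Q n z)| ≤ C * (|n| + |z|) ^ 5)
    (hcont : ∀ z : ℝ, |z| ≤ δ → ContinuousOn (fun n => g n z) (Icc (-r) r))
    {z : ℝ} (hz : |z| ≤ δ) (hz1 : |z| ≤ 1) (hKz : K * |z| ≤ r) :
    |sSup ((fun n => g n z) '' Icc (-r) r) - (N - m * z ^ 4)| ≤
      (C * (K + 1) ^ 5 + C * (max 1 (2 * (|m| + 32 * C + C * (K + 1) ^ 5) / lam) + 1) ^ 5) * |z| ^ 5 := by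
  -- the cross-section image is compact and non-empty: the `sSup` is attained and bounds every value
  have hIc : IsCompact ((fun n => g n z) '' Icc (-r) r) := isCompact_Icc.image_of_continuousOn (hcont z hz)
  have hne : ((fun n => g n z) '' Icc (-r) r).Nonempty := ⟨g 0 z, 0, ⟨by linarith, hr.le⟩, rfl⟩
  obtain ⟨nstar, hnstar, hmax⟩ := hIc.sSup_mem hne
  have hle : ∀ n ∈ Icc (-r) r, g n z ≤ sSup ((fun n => g n z) '' Icc (-r) r) := fun n hn =>
    le_csSup hIc.bddAbove ⟨n, hn, rfl⟩
  set M := sSup ((fun n => g n z) '' Icc (-r) r) with hMdef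
  have hK0 : 0 ≤ K := (abs_nonneg _).trans hK
  have hz0 : 0 ≤ |z| := abs_nonneg z
  set B : ℝ := max 1 (2 * (|m| + 32 * C + C * (K + 1) ^ 5) / lam) with hB
  have hB1 : 1 ≤ B := le_max_left _ _
  have hB0 : 0 ≤ B := zero_le_one.trans hB1
  -- ### lower bound at `n₁ = η₀ z`
  have hn₁r : |η₀ * z| ≤ r := by rw [abs_mul]; exact (mul_le_mul_of_nonneg_right hK hz0).trans hKz
  have hn₁mem : η₀ * z ∈ Icc (-r) r := ⟨(abs_le.1 hn₁r).1, (abs_le.1 hn₁r).2⟩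
  have hlow : N - m * z ^ 4 - C * (K + 1) ^ 5 * |z| ^ 5 ≤ M := by
    have h1 := (abs_le.1 (hH (η₀ * z) z hn₁r hz)).1
    have h2 := hle _ hn₁mem
    rw [hhom, hη₀] at h1
    have hrem : C * (|η₀ * z| + |z|) ^ 5 ≤ C * (K + 1) ^ 5 * |z| ^ 5 := by
      have e : |η₀ * z| + |z| = (|η₀| + 1) * |z| := by rw [abs_mul]; ring
      rw [e, mul_pow]
      have h3 : (|η₀| + 1) ^ 5 ≤ (K + 1) ^ 5 := pow_le_pow_left₀ (by positivity) (by linarith) 5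
      have h4 : (|η₀| + 1) ^ 5 * |z| ^ 5 ≤ (K + 1) ^ 5 * |z| ^ 5 := mul_le_mul_of_nonneg_right h3 (by positivity)
      have h5 := mul_le_mul_of_nonneg_left h4 hC
      have e2 : C * ((K + 1) ^ 5 * |z| ^ 5) = C * (K + 1) ^ 5 * |z| ^ 5 := by ring
      linarith [h5, e2]
    linarith [h1, h2, hrem]
  -- ### upper bound at the maximiser `n*`
  have hnr : |nstar| ≤ r := abs_le.2 ⟨hnstar.1, hnstar.2⟩
  have hM : M = g nstar z := hmax.symm
  have h1 := (abs_le.1 (hH nstar z hnr hz)).2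
  -- `Q(n*, z) ≥ m z⁴`
  have hQm : m * z ^ 4 ≤ Q nstar z := by
    rcases eq_or_ne z 0 with hz' | hz'
    · rw [hz']
      have h0 := hdef nstar 0
      have hn4 : 0 ≤ nstar ^ 4 := by positivity
      have e1 : m * (0:ℝ) ^ 4 = 0 := by ring
      have e2 : lam * (nstar ^ 4 + (0:ℝ) ^ 4) = lam * nstar ^ 4 := by ring
      rw [e1]; rw [e2] at h0
      exact (mul_nonneg hlam.le hn4).trans h0
    · have e : nstar = nstar / z * z := by field_simp
      rw [e, hhom, mul_comm]
      exact mul_le_mul_of_nonneg_left (hm _) (by positivity)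
  -- the remainder at `n*` : `C(|n*|+|z|)⁵ ≤ 32C|n*|⁵ + 32C|z|⁵`, `32C|n*|⁵ ≤ (λ/2) n*⁴`
  have hrem1 : C * (|nstar| + |z|) ^ 5 ≤ 32 * C * |nstar| ^ 5 + 32 * C * |z| ^ 5 := by
    have h := mul_le_mul_of_nonneg_left (add_pow_five_le (abs_nonneg nstar) hz0) hC
    linarith
  have hrem2 : 32 * C * |nstar| ^ 5 ≤ lam / 2 * nstar ^ 4 := by
    rw [abs_pow_five]
    have h32 : 32 * C * |nstar| ≤ lam / 2 := by
      have := mul_le_mul_of_nonneg_left hnr (by positivity : (0:ℝ) ≤ 32 * C)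
      linarith
    calc 32 * C * (|nstar| * nstar ^ 4) = (32 * C * |nstar|) * nstar ^ 4 := by ring
      _ ≤ lam / 2 * nstar ^ 4 := mul_le_mul_of_nonneg_right h32 (by positivity)
  -- smallness of the maximiser: `n*⁴ ≤ B z⁴`, hence `|n*| ≤ B|z|`
  have hz54 : |z| ^ 5 ≤ z ^ 4 := by
    rw [abs_pow_five]
    have h4 : 0 ≤ z ^ 4 := by positivity
    nlinarith
  have hsmall4 : nstar ^ 4 ≤ B * z ^ 4 := by
    have hd := hdef nstar z
    -- `λ(n*⁴ + z⁴) ≤ Q(n*,z) ≤ N − g(n*,z) + C(|n*|+|z|)⁵` and `g(n*,z) = M ≥ N − m z⁴ − C(K+1)⁵|z|⁵`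
    have hQup : Q nstar z ≤ m * z ^ 4 + C * (K + 1) ^ 5 * |z| ^ 5 + C * (|nstar| + |z|) ^ 5 := by
      have := hlow; rw [hM] at this; linarith
    have hmain : lam / 2 * nstar ^ 4 ≤ (|m| + 32 * C + C * (K + 1) ^ 5) * z ^ 4 := by
      have hmz : m * z ^ 4 ≤ |m| * z ^ 4 := mul_le_mul_of_nonneg_right (le_abs_self m) (by positivity)
      have hK5 : C * (K + 1) ^ 5 * |z| ^ 5 ≤ C * (K + 1) ^ 5 * z ^ 4 := mul_le_mul_of_nonneg_left hz54 (by positivity)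
      have h32 : 32 * C * |z| ^ 5 ≤ 32 * C * z ^ 4 := mul_le_mul_of_nonneg_left hz54 (by positivity)
      have hz4 : 0 ≤ lam * z ^ 4 := by positivity
      have e : (|m| + 32 * C + C * (K + 1) ^ 5) * z ^ 4 = |m| * z ^ 4 + 32 * C * z ^ 4 + C * (K + 1) ^ 5 * z ^ 4 := by ring
      rw [e]
      have hd' : lam * nstar ^ 4 + lam * z ^ 4 ≤ Q nstar z := by linarith [hd]
      linarith [hQup, hrem1, hrem2]
    have hB' : 2 * (|m| + 32 * C + C * (K + 1) ^ 5) / lam ≤ B := le_max_right _ _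
    have : nstar ^ 4 ≤ 2 * (|m| + 32 * C + C * (K + 1) ^ 5) / lam * z ^ 4 := by
      rw [div_mul_eq_mul_div, le_div_iff₀ hlam]; nlinarith
    exact this.trans (mul_le_mul_of_nonneg_right hB' (by positivity))
  have hsmall : |nstar| ≤ B * |z| := by
    have h4 : |nstar| ^ 4 ≤ (B * |z|) ^ 4 := by
      rw [pow_abs, mul_pow, pow_abs, abs_of_nonneg (by positivity : (0:ℝ) ≤ z ^ 4),
        abs_of_nonneg (by positivity : (0:ℝ) ≤ nstar ^ 4)]
      have hB3 : 1 ≤ B ^ 3 := one_le_pow₀ hB1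
      have hB4 : B ≤ B ^ 4 :=
        calc B = B * 1 := by ring
          _ ≤ B * B ^ 3 := mul_le_mul_of_nonneg_left hB3 hB0
          _ = B ^ 4 := by ring
      have hz4 : 0 ≤ z ^ 4 := by positivity
      exact hsmall4.trans (mul_le_mul_of_nonneg_right hB4 hz4)
    exact (pow_le_pow_iff_left₀ (abs_nonneg _) (by positivity) (by norm_num : (4:ℕ) ≠ 0)).1 h4
  have hup : M ≤ N - m * z ^ 4 + C * (B + 1) ^ 5 * |z| ^ 5 := by
    have hrem : C * (|nstar| + |z|) ^ 5 ≤ C * (B + 1) ^ 5 * |z| ^ 5 := by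
      have h3 : |nstar| + |z| ≤ (B + 1) * |z| := by
        have e : (B + 1) * |z| = B * |z| + |z| := by ring
        rw [e]; linarith
      have h4 : (|nstar| + |z|) ^ 5 ≤ ((B + 1) * |z|) ^ 5 := pow_le_pow_left₀ (by positivity) h3 5
      have h5 := mul_le_mul_of_nonneg_left h4 hC
      have e2 : C * ((B + 1) * |z|) ^ 5 = C * (B + 1) ^ 5 * |z| ^ 5 := by ring
      linarith [h5, e2]
    rw [hM]; linarith
  have hK5 : 0 ≤ C * (K + 1) ^ 5 * |z| ^ 5 := by positivity
  have hB5 : 0 ≤ C * (B + 1) ^ 5 * |z| ^ 5 := by positivity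
  have e : (C * (K + 1) ^ 5 + C * (B + 1) ^ 5) * |z| ^ 5 = C * (K + 1) ^ 5 * |z| ^ 5 + C * (B + 1) ^ 5 * |z| ^ 5 := by ring
  rw [e]
  exact abs_le.2 ⟨by linarith, by linarith⟩

end Summit.NavierStokesRegularity.NavierStokesRegularity.Theorems.PoloidalWindowDoorLrcModEntireTwistingTHFlatLever
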